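import Summits.BirchSwinnertonDyer.Rank1Residual.X10.MuTransferThreeEulerHalf
import Summits.BirchSwinnertonDyer.Rank1Residual.X10.MuTransferThreeIntModel
import HarnessLib

/-!
# Class X10 at `p = 3` (X10a′ and X10b = N2), the `3 ∤ #Ш(E/ℚ)_an` pairs: `KatoMuTransferThree` ∧ one
# unit coefficient of `L_3(f, α)` ∧ `ord₃ #Ш_an = 0` ⟹ Miller's `BSD(E,3)` — in rank `0` (either image,
# no rational main conjecture, no booked certificate) and, with the Schneider certificate, in rank `1`;
# plus the literal-model RECORD shape (cell `b2b-bsdres`, unit `b2b-bsdres-x10` = N2 class lead,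
# GEN 36; TOOL — theorems only, no definition, no named fact, nothing booked)

HONEST FRAMING (run/shared/lean/b2b/bsd-rank1-residual/, verbatim in every file): the goal of the
cell is to DELETE the COMBINATION-SHAPED residual classes of the Birch–Swinnerton-Dyer formula for
ALL analytic-rank `≤ 1` elliptic curves over `ℚ` — "full BSD formula for every rank `≤ 1` curve in
class `C`" assembled STRICTLY from published theorems — so that the rank-`≤ 1` remainder becomes
exactly the CONSTRUCTION-SHAPED classes, which are TYPED (missing-input `Prop`s), NOT attempted.
This is not "finishing BSD". Class X10b (N2) keeps its label CONSTRUCTION-SHAPED / NEEDS X_A3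
(RESIDUAL-MAP §I N2); nothing is booked by this file; no census number moves.

## What (x10 GEN 36, X10-AUDIT §42; companion of `X10/MuTransferThreeEulerHalf.lean` (GEN 35) and
## `X10/MuTransferThreeIntModel.lean` (GEN 35))

GEN 35 proved the rank-`1` statement `bsdp_three_rankOne_of_katoMuTransferThree_of_shaAn_unit`: on
N2 ∩ {r = 1}, at a pair whose analytic order of `Ш` is a `3`-adic unit, `KatoMuTransferThree` ∧ the
finite `μ^an = 0` certificate ∧ the Schneider certificate give Miller's `BSD(E,3)` — the lower half
`ord₃ #Ш_an ≤ ord₃ #Ш` being VACUOUS when `ord₃ #Ш_an = 0`. The rank-`0` twin was left implicit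
(GEN 34/35 state the Euler-system half `Typed.MissingUpperBoundAt W 3` and `X_A3 ⟺ BSD(E,3)`). THIS
FILE writes it out, in the three currencies the lane uses:

* `bsdp_three_of_katoMuTransferThree_of_shaAn_unit` — **class-free, EITHER mod-`3` image**: `3` good
  ordinary, `E[3]` irreducible, `L(E,1) ≠ 0`, `KatoMuTransferThree` ∧ `hcertA` ∧ `ord₃ #Ш_an = 0` ⟹
  `BSDp W 3` (surjective image: the certificate and the node are idle — Kato (3) on the good-ordinary
  tower, x10 GEN 5/13; non-surjective = N2: GEN 35's `missingUpperBoundAt_three_of_katoMuTransferThree`);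
* `bsdp_three_rankZero_of_katoMuTransferThree_of_shaAn_unit` (N2 ∩ {r = 0}) and
  `bsdp_three_rankZero_of_katoMuTransferThree_of_shaAn_unit_anyImage` (class X10 ∩ {r = 0}) — the same
  in the class currency `ClassX10 W 3`;
* `bsdp_three_of_katoMuTransferThree_of_shaAn_unit_onClassX10b` — **N2, BOTH ranks**: `ClassX10 W 3`,
  `¬ Surj W 3`, `ord₃ #Ш_an = 0`, the Schneider certificate at the rank-`1` pairs ⟹ `BSDp W 3` from
  `KatoMuTransferThree` ∧ `hcertA` and PUBLISHED facts only (rank `1` = GEN 35's theorem verbatim);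
* `MuZeroRoad.bsdp_three_of_ainvs_of_katoMuTransferThree_of_shaAn_unit` — the RECORD shape: the same
  read off a literal integer model `[a1,a2,a3,a4,a6]` with the cell's `decide`-able certificates (good
  ordinary `3` and `E[3]` irreducible by point counts, `goodOrdIrr_three_of_ainvs_of_countPoints`, GEN 34).

READING for N2 (evidence, no label moves). The census of record has `ord₃ #Ш(E/ℚ)_an = 0` on 292 of
the 313 N2 cells (all 39 rank-`1` cells; 253 of the 274 rank-`0` cells — the 21 others are the N2
`Ш`-cells, `9 ∣ #Ш_an`, closed by visibility / Cha / descent roads), and the TWO-ENGINE `μ^an(E,3) = 0`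
certificate on 313/313 (iw-1 GEN 11 `MU-CENSUS-N2N3`, engines B × C, re-joined for N2 by iw-2 GEN 83
as `b2b-bsdres-iw-2/tables/n2_mucert3_record.tsv` @038b64f23d25c9d7: `λ^an ∈ {0,2,4,6,8,12}` at
`r = 0`, `∈ {3,5,7,11,13}` at `r = 1`; folded for the class as `class-closure/N2/MUCERT3-x10g36.tsv`).
Hence on those 292 cells Miller's `BSD(E,3)` — BOOKED independently by the lane's exact `3`-descent /
Heegner-index certificates (R146.1 / R171.3) — has a SECOND ROAD through exactly ONE open node,
`KatoMuTransferThree` (cell `bsd-smallim`, KOLY-MEMO §5.7 at `p = 3`), plus finite certificates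
(`hcertA`; `hSch` at `r = 1`) and PUBLISHED facts, with NO rational main conjecture (no Yan–Zhu flag)
and NO descent datum of the curve. Where `3` enters: only through the hypotheses `p = 3` /
`ClassX10`; every engine used is stated for odd `p`.

References: [Kato2004Asterisque] Thm. 17.4 (2), (3) (p. 273); [GreenbergLNM1716] §1 Conj. 1.11,
Thm. 4.1 (p. 102); [PerrinRiou1987] §1.4 Cor. 1.8; [BalakrishnanMullerStein2015] Thm. 1.7;
[Wuthrich2014] Lemma 20, Prop. 21; [Mazur1978] Prop. 6.3 (1); [Miller2011LMS] Def. 1.1; cell files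
X10-AUDIT.md §41, §42; HOME/pub/bsd-smallim/koly/KOLY-MEMO.md §5.7, MU-TRANSFER-PROOF.md §7 (ii).
-/

set_option autoImplicit false

noncomputable section

open scoped Classical MatrixGroups ModularForm

open CongruenceSubgroup WeierstrassCurve Literature.NumberTheory.EllipticCurves
  Literature.NumberTheory.EllipticCurves.ModularForms Literature.NumberTheory.EllipticCurves.Rank1Residual
  Literature.NumberTheory.EllipticCurves.Rank1Residual.Typed
  Literature.NumberTheory.EllipticCurves.Wuthrich2014
  Literature.NumberTheory.EllipticCurves.Rank1Residual.X11RankOneCertificates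
  Summit.BirchSwinnertonDyer.BirchSwinnertonDyer.Rank1Residual.IntModel
  Summit.BirchSwinnertonDyer.BirchSwinnertonDyer.Rank1Residual.X11RankOne
  Summit.BirchSwinnertonDyer.BirchSwinnertonDyer.Theorems.Rank1ResidualX1Defs
  Summit.BirchSwinnertonDyer.BirchSwinnertonDyer.Rank1Residual

namespace Summit.BirchSwinnertonDyer.Rank1Residual.X10

/-! ### §1. Class-free, EITHER image: rank `0`, `ord₃ #Ш_an = 0` -/

section ClassFree

variable (W : WeierstrassCurve ℚ) [W.IsElliptic] [W.IsGloballyMinimal]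

/-- **`3` good ordinary, `E[3]` irreducible, `L(E,1) ≠ 0`, EITHER mod-`3` image, at a pair with
`ord₃ #Ш(E/ℚ)_an = 0`: `KatoMuTransferThree` ∧ one unit coefficient of `L_3(f, α)` ⟹ Miller's
`BSD(E,3)`.** The upper half `ord₃ #Ш ≤ ord₃ #Ш_an` is GEN 35's
`missingUpperBoundAt_three_of_katoMuTransferThree` (surjective image: Kato (3) on the good-ordinary
tower, certificate idle; non-surjective: the `μ`-transfer feeds GEN 34's `μ`-zero road); the lower
half is vacuous at `ord₃ #Ш_an = 0` (`hunit`, census datum); `L(E,1) ≠ 0` gives analytic rank `0`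
(`analyticRank_eq_zero_iff_holds`, continuation from the newform supplied by `hmodP`), so GZK (`hGZK`)
assembles `BSDp W 3` (`bsdp_of_missingPPartAt`). PUBLISHED binders `hK` (Kato 17.4), `hS` + `hMT`
(Greenberg Thm. 4.1 at odd `p`), `hmodP`, `hGZK`, `h3`; CELL input `hT3` (open node); finite
certificates `hcertA`, `hunit`. No rational main conjecture; nothing booked.
[cite: Kato2004Asterisque, Thm. 17.4 (2), (3) (p. 273)] [cite: GreenbergLNM1716, §1 Conj. 1.11 and Thm. 4.1 (p. 102)]
[cite: Wuthrich2014, Lemma 20 (p. 399) and Prop. 21 (p. 400)] [cite: Miller2011LMS, Def. 1.1 (arXiv:1010.2431 p. 3)] -/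
theorem bsdp_three_of_katoMuTransferThree_of_shaAn_unit
    (hS : Schneider1985_order_charGenerator_odd) (hMT : mazur_tate_sigma_exists_odd)
    (hmodP : nonempty_modularParametrizationData)
    (hGZK : rank_eq_analyticRank_of_analyticRank_le_one)
    (h3 : realPeriodRat_eq_unit_mul_plusPeriod_three) (hT3 : KatoMuTransferThree)
    (hK : ∀ (κ : ZpExtension ℚ 3) (γ : Field.absoluteGaloisGroup ℚ) [NeZero (W.conductorNorm ℤ)]
      (f : CuspForm (Gamma0 (W.conductorNorm ℤ)) 2), kato_divisibility W 3 (κ := κ) (γ := γ) (f := f))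
    (hgood : W.HasGoodReductionAtPrime 3) (hord : ¬ ((3 : ℕ) : ℤ) ∣ W.frobeniusTrace 3)
    (hirr : W.HasIrreducibleModPGaloisRep 3) (hL : W.entireLFunction 1 ≠ 0)
    (hcertA : ∀ {N : ℕ} [NeZero N] (f : CuspForm (Gamma0 N) 2), IsNewformOf W f →
      ∃ n : ℕ, ‖PowerSeries.coeff n (padicLFunction f (unitRoot W 3 : ℚ_[3]))‖ = 1)
    (hunit : ∃ q : ℚ, shaAn W = (q : ℂ) ∧ padicValRat 3 q = 0) : BSDp W 3 := by
  haveI : NeZero (W.conductorNorm ℤ) := ⟨(W.conductorNorm_pos_holds).ne'⟩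
  obtain ⟨Dm⟩ := hmodP W
  have hr0 : W.analyticRank = 0 :=
    (W.analyticRank_eq_zero_iff_holds Dm.isNewformOf.hasEntireLFunction).mpr hL
  refine bsdp_of_missingPPartAt W 3 hGZK (by rw [hr0]; exact Nat.zero_le _)
    (missingPPartAt_of_lower_of_upper W 3 ?_
      (missingUpperBoundAt_three_of_katoMuTransferThree W hS hMT hmodP hGZK h3 hT3 hK hgood hord hirr
        hL hcertA))
  obtain ⟨q, hq, hv⟩ := hunit
  exact ⟨q, hq, by rw [hv]; exact_mod_cast Nat.zero_le _⟩

end ClassFree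

/-! ### §2. The class currency: N2 ∩ {r = 0} and class X10 ∩ {r = 0} -/

section ClassCurrency

variable (W : WeierstrassCurve ℚ) [W.IsElliptic] [W.IsGloballyMinimal]

/-- **N2 ∩ {r = 0} at a pair with `ord₃ #Ш(E/ℚ)_an = 0`: `KatoMuTransferThree` ∧ certificate ⟹
Miller's `BSD(E,3)`** — the rank-`0` twin of GEN 35's
`bsdp_three_rankOne_of_katoMuTransferThree_of_shaAn_unit`: the upper half is GEN 35's
`missingUpperBoundAt_three_rankZero_of_katoMuTransferThree`, the lower half is vacuous (`hunit`).
Every binder is a PUBLISHED named fact, the open node `KatoMuTransferThree`, or a finite per-pair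
certificate; no flag; nothing booked (the census pairs are closed independently by the lane's exact
`3`-descent). [cite: Kato2004Asterisque, Thm. 17.4 (2) (p. 273)]
[cite: GreenbergLNM1716, §1 Conj. 1.11 and Thm. 4.1 (p. 102)] [cite: Miller2011LMS, Def. 1.1 (arXiv:1010.2431 p. 3)] -/
theorem bsdp_three_rankZero_of_katoMuTransferThree_of_shaAn_unit
    (hS : Schneider1985_order_charGenerator_odd) (hMT : mazur_tate_sigma_exists_odd)
    (hmodP : nonempty_modularParametrizationData)
    (hGZK : rank_eq_analyticRank_of_analyticRank_le_one)
    (h3 : realPeriodRat_eq_unit_mul_plusPeriod_three) (hT3 : KatoMuTransferThree)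
    (hK : ∀ (κ : ZpExtension ℚ 3) (γ : Field.absoluteGaloisGroup ℚ) [NeZero (W.conductorNorm ℤ)]
      (f : CuspForm (Gamma0 (W.conductorNorm ℤ)) 2), kato_divisibility W 3 (κ := κ) (γ := γ) (f := f))
    (hX : ClassX10 W 3) (hns : ¬ Surj W 3) (hr0 : W.analyticRank = 0)
    (hcertA : ∀ {N : ℕ} [NeZero N] (f : CuspForm (Gamma0 N) 2), IsNewformOf W f →
      ∃ n : ℕ, ‖PowerSeries.coeff n (padicLFunction f (unitRoot W 3 : ℚ_[3]))‖ = 1)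
    (hunit : ∃ q : ℚ, shaAn W = (q : ℂ) ∧ padicValRat 3 q = 0) : BSDp W 3 := by
  refine bsdp_of_missingPPartAt W 3 hGZK (by rw [hr0]; exact Nat.zero_le _)
    (missingPPartAt_of_lower_of_upper W 3 ?_
      (missingUpperBoundAt_three_rankZero_of_katoMuTransferThree W hS hMT hmodP hGZK h3 hT3 hK hX hns
        hr0 hcertA))
  obtain ⟨q, hq, hv⟩ := hunit
  exact ⟨q, hq, by rw [hv]; exact_mod_cast Nat.zero_le _⟩

/-- **Class X10 ∩ {r = 0}, EITHER mod-`3` image, at a pair with `ord₃ #Ш(E/ℚ)_an = 0`: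
`KatoMuTransferThree` ∧ certificate ⟹ Miller's `BSD(E,3)`** — upper half = GEN 35's
`missingUpperBoundAt_three_rankZero_of_katoMuTransferThree_anyImage` (surjective: the good-ordinary
tower + Kato (3); otherwise the transfer), lower half vacuous. No image hypothesis, no flag.
[cite: Kato2004Asterisque, Thm. 17.4 (2), (3) (p. 273)] [cite: Wuthrich2014, Lemma 20 (p. 399) and Prop. 21 (p. 400)]
[cite: Miller2011LMS, Def. 1.1 (arXiv:1010.2431 p. 3)] -/
theorem bsdp_three_rankZero_of_katoMuTransferThree_of_shaAn_unit_anyImage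
    (hS : Schneider1985_order_charGenerator_odd) (hMT : mazur_tate_sigma_exists_odd)
    (hmodP : nonempty_modularParametrizationData)
    (hGZK : rank_eq_analyticRank_of_analyticRank_le_one)
    (h3 : realPeriodRat_eq_unit_mul_plusPeriod_three) (hT3 : KatoMuTransferThree)
    (hK : ∀ (κ : ZpExtension ℚ 3) (γ : Field.absoluteGaloisGroup ℚ) [NeZero (W.conductorNorm ℤ)]
      (f : CuspForm (Gamma0 (W.conductorNorm ℤ)) 2), kato_divisibility W 3 (κ := κ) (γ := γ) (f := f))
    (hX : ClassX10 W 3) (hr0 : W.analyticRank = 0)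
    (hcertA : ∀ {N : ℕ} [NeZero N] (f : CuspForm (Gamma0 N) 2), IsNewformOf W f →
      ∃ n : ℕ, ‖PowerSeries.coeff n (padicLFunction f (unitRoot W 3 : ℚ_[3]))‖ = 1)
    (hunit : ∃ q : ℚ, shaAn W = (q : ℂ) ∧ padicValRat 3 q = 0) : BSDp W 3 := by
  refine bsdp_of_missingPPartAt W 3 hGZK (by rw [hr0]; exact Nat.zero_le _)
    (missingPPartAt_of_lower_of_upper W 3 ?_
      (missingUpperBoundAt_three_rankZero_of_katoMuTransferThree_anyImage W hS hMT hmodP hGZK h3 hT3 hK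
        hX hr0 hcertA))
  obtain ⟨q, hq, hv⟩ := hunit
  exact ⟨q, hq, by rw [hv]; exact_mod_cast Nat.zero_le _⟩

/-- **N2 (BOTH ranks) at a pair with `ord₃ #Ш(E/ℚ)_an = 0`: `KatoMuTransferThree` ∧ the finite
certificates ⟹ Miller's `BSD(E,3)`.** `ClassX10 W 3` splits the pair into analytic rank `0` (then
`bsdp_three_rankZero_of_katoMuTransferThree_of_shaAn_unit`; the Schneider certificate is not used) or
analytic rank `1` (then GEN 35's `bsdp_three_rankOne_of_katoMuTransferThree_of_shaAn_unit`, with the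
Schneider certificate `hSch` = non-degeneracy of THE canonical cyclotomic `3`-adic height, rider I1).
PUBLISHED binders: Kato 17.4 (2) (`hK`), Perrin-Riou–Schneider at odd `p` (`hS`), Perrin-Riou 1987
(`hPR`), the Mazur–Tate σ (`hMT`), modularity (`hmodP`), GZK (`hGZK`), the period unit at `3` (`h3`);
CELL input: `KatoMuTransferThree`; finite per-pair certificates: `hcertA` (unit coefficient), `hunit`
(`3 ∤ #Ш_an`), `hSch` (at `r = 1`). No rational main conjecture, no flag; nothing booked. On the census
of record this is 292 of the 313 N2 cells (all but the 21 `Ш`-cells with `9 ∣ #Ш_an`).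
[cite: Kato2004Asterisque, Thm. 17.4 (2) (p. 273)] [cite: PerrinRiou1987, §1.4 Cor. 1.8]
[cite: BalakrishnanMullerStein2015, Thm. 1.7] [cite: GreenbergLNM1716, §1 Conj. 1.11 and Thm. 4.1 (p. 102)]
[cite: Miller2011LMS, Def. 1.1 (arXiv:1010.2431 p. 3)] -/
theorem bsdp_three_of_katoMuTransferThree_of_shaAn_unit_onClassX10b
    (hS : Schneider1985_order_charGenerator_odd) (hPR : perrinRiou_rankOne_leadingTerms_odd)
    (hMT : mazur_tate_sigma_exists_odd) (hmodP : nonempty_modularParametrizationData)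
    (hGZK : rank_eq_analyticRank_of_analyticRank_le_one)
    (h3 : realPeriodRat_eq_unit_mul_plusPeriod_three) (hT3 : KatoMuTransferThree)
    (hK : ∀ (κ : ZpExtension ℚ 3) (γ : Field.absoluteGaloisGroup ℚ) [NeZero (W.conductorNorm ℤ)]
      (f : CuspForm (Gamma0 (W.conductorNorm ℤ)) 2), kato_divisibility W 3 (κ := κ) (γ := γ) (f := f))
    (hX : ClassX10 W 3) (hns : ¬ Surj W 3)
    (hSch : W.analyticRank = 1 → ∀ Dh : PAdicHeightData W 3, Dh.IsCanonical → SchneiderConjecture Dh)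
    (hcertA : ∀ {N : ℕ} [NeZero N] (f : CuspForm (Gamma0 N) 2), IsNewformOf W f →
      ∃ n : ℕ, ‖PowerSeries.coeff n (padicLFunction f (unitRoot W 3 : ℚ_[3]))‖ = 1)
    (hunit : ∃ q : ℚ, shaAn W = (q : ℂ) ∧ padicValRat 3 q = 0) : BSDp W 3 := by
  rcases hX.2.2.2 with ⟨hr0, -⟩ | ⟨hr1, -⟩
  · exact bsdp_three_rankZero_of_katoMuTransferThree_of_shaAn_unit W hS hMT hmodP hGZK h3 hT3 hK hX hns
      hr0 hcertA hunit
  · exact bsdp_three_rankOne_of_katoMuTransferThree_of_shaAn_unit W hS hPR hMT hmodP hGZK h3 hT3 hK hX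
      hns hr1 (hSch hr1) hcertA hunit

end ClassCurrency

/-! ### §3. The same read off a literal integer model — the RECORD shape -/

namespace MuZeroRoad

/-- **`KatoMuTransferThree` ∧ certificate ∧ `ord₃ #Ш(E/ℚ)_an = 0` ⟹ Miller's `BSD(E,3)`, for a cell
given by a literal integer model** `[a1,a2,a3,a4,a6]` (`integralModelInt W`): good ordinary `3` and
`E[3]` irreducible are READ OFF the model by the cell's `decide`-able certificates (`3 ∤ Δ`, the point
count `n3` at `3` with `3 ∤ 4 − n3`, and one good prime `ℓ ∤ 6Δ` whose Frobenius polynomial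
`t² − a_ℓ t + ℓ` has no root mod `3` — Mazur's Prop. 6.3 (1) argument, GEN 34's
`goodOrdIrr_three_of_ainvs_of_countPoints`); then §1's class-free theorem (either image). Kato's
Thm. 17.4 is taken in the uniform shape `hkato` of GEN 34's records. Census binders per cell: `hL`
(`L(E,1) ≠ 0`), `hcertA` (the two-engine unit-coefficient certificate, iw-1 GEN 11 / iw-2 GEN 83),
`hunit` (`3 ∤ #Ш_an`). Per pair; a second road to the booked `BSD(E,3)`; nothing booked.
[cite: Kato2004Asterisque, Thm. 17.4 (2), (3) (p. 273)] [cite: Mazur1978, §6 Prop. 6.3 (1) (p. 153)]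
[cite: GreenbergLNM1716, §1 Conj. 1.11 and Thm. 4.1] [cite: Miller2011LMS, Def. 1.1 (arXiv:1010.2431 p. 3)] -/
theorem bsdp_three_of_ainvs_of_katoMuTransferThree_of_shaAn_unit
    (hkato : ∀ (W : WeierstrassCurve ℚ) [W.IsElliptic] [W.IsGloballyMinimal] (p : ℕ) [Fact p.Prime]
      (κ : ZpExtension ℚ p) (γ : Field.absoluteGaloisGroup ℚ) (N : ℕ) [NeZero N]
      (f : CuspForm (Gamma0 N) 2), kato_divisibility W p (κ := κ) (γ := γ) (f := f))
    (hS : Schneider1985_order_charGenerator_odd) (hMT : mazur_tate_sigma_exists_odd)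
    (hmodP : nonempty_modularParametrizationData)
    (hGZK : rank_eq_analyticRank_of_analyticRank_le_one)
    (h3 : realPeriodRat_eq_unit_mul_plusPeriod_three) (hT3 : KatoMuTransferThree)
    (a1 a2 a3 a4 a6 : ℤ) {W : WeierstrassCurve ℚ} [W.IsElliptic] [W.IsGloballyMinimal]
    (hW : integralModelInt W = ⟨a1, a2, a3, a4, a6⟩)
    [Fact (Nat.Prime 3)] (ℓ n n3 : ℕ) [Fact ℓ.Prime]
    (h3Δ : ¬ (3 : ℤ) ∣ discOf [a1, a2, a3, a4, a6])
    (hc3 : countPoints [a1, a2, a3, a4, a6] 3 = n3) (hord3 : ¬ (3 : ℤ) ∣ (3 : ℤ) + 1 - n3)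
    (hℓ2 : ℓ ≠ 2) (hℓ3 : ℓ ≠ 3) (hℓΔ : ¬ (ℓ : ℤ) ∣ discOf [a1, a2, a3, a4, a6])
    (hc : countPoints [a1, a2, a3, a4, a6] ℓ = n)
    (hnoroot : ∀ t : ℕ, t < 3 → ¬ (3 : ℤ) ∣ (t : ℤ) ^ 2 - ((ℓ : ℤ) + 1 - n) * t + ℓ)
    (hL : W.entireLFunction 1 ≠ 0)
    (hcertA : ∀ {N : ℕ} [NeZero N] (f : CuspForm (Gamma0 N) 2), IsNewformOf W f →
      ∃ n : ℕ, ‖PowerSeries.coeff n (padicLFunction f (unitRoot W 3 : ℚ_[3]))‖ = 1)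
    (hunit : ∃ q : ℚ, shaAn W = (q : ℂ) ∧ padicValRat 3 q = 0) : BSDp W 3 := by
  obtain ⟨hgood, hord, hirr⟩ := goodOrdIrr_three_of_ainvs_of_countPoints a1 a2 a3 a4 a6 hW ℓ n n3 h3Δ
    hc3 hord3 hℓ2 hℓ3 hℓΔ hc hnoroot
  exact bsdp_three_of_katoMuTransferThree_of_shaAn_unit W hS hMT hmodP hGZK h3 hT3
    (fun κ γ _ f ↦ hkato W 3 κ γ (W.conductorNorm ℤ) f) hgood hord hirr hL hcertA hunit

end MuZeroRoad

end Summit.BirchSwinnertonDyer.Rank1Residual.X10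

end
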